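import Mathlib.AlgebraicGeometry.AffineScheme
import Mathlib.RingTheory.Localization.LocalizationLocalization
import Mathlib.RingTheory.Localization.AtPrime.Basic
import HarnessLib

/-!
# The stalk at a generization is a localization of the stalk (Stacks, Tag 01J7; EGA I 2.4)

Topic: `Literature/AlgebraicGeometry/Resolution`. For a scheme `X` and a specialization
`x' ⤳ x` of points, the specialization map of stalks `𝒪_{X,x} → 𝒪_{X,x'}`
(`X.presheaf.stalkSpecializes`) exhibits `𝒪_{X,x'}` as the localization of `𝒪_{X,x}` at the
prime `𝔭_{x'} = (𝔪_{x'})ᶜᵒⁿᵗʳ` (inside an affine open `Spec A ∋ x`, which contains every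
generization of `x`: `𝒪_{X,x} = A_𝔭`, `𝒪_{X,x'} = A_𝔮` with `𝔮 ⊆ 𝔭`, and `A_𝔮 = (A_𝔭)_{𝔮A_𝔭}`),
and every prime of `𝒪_{X,x}` arises this way from a unique generization. This is the
dictionary "points of `Spec 𝒪_{X,x}` = generizations of `x`" (Stacks 01J7; EGA I 2.4.2) in the
form needed to pass between the Fitting ideals `Fitt₁(Ω_{X/S})_x` at a point and at its
generizations (de Jong 1996, 2.21, `AlterationsSemiStableThickness.lean`). All proved:

* `isLocalizationAtPrime_stalkSpecializes` — `𝒪_{X,x'}` is the localization of `𝒪_{X,x}` at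
  the contraction of `𝔪_{x'}` along `stalkSpecializes`;
* `exists_specializes_comap_stalkSpecializes_eq` — every prime of `𝒪_{X,x}` is the contraction
  of `𝔪_{x'}` for some generization `x' ⤳ x`.

## Sources

* The Stacks Project, Tag 01J7 (points of `Spec 𝒪_{X,x}`).
* A. Grothendieck, J. Dieudonné, *EGA I* (1960), 2.4.2.
-/

noncomputable section

open CategoryTheory AlgebraicGeometry TopologicalSpace IsLocalRing

namespace Literature.AlgebraicGeometry.Resolution

universe u

variable {X : Scheme.{u}}

/-- **The stalk at a generization is the localization of the stalk** (Stacks 01J7): for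
`x' ⤳ x` in a scheme `X`, the specialization map `𝒪_{X,x} → 𝒪_{X,x'}` is a localization at
the prime `(stalkSpecializes)⁻¹(𝔪_{x'})`. [cite: StacksProject, Tag 01J7] -/
theorem isLocalizationAtPrime_stalkSpecializes {x x' : X} (h : x' ⤳ x) :
    letI := (X.presheaf.stalkSpecializes h).hom.toAlgebra
    IsLocalization.AtPrime (X.presheaf.stalk x')
      ((maximalIdeal (X.presheaf.stalk x')).comap (X.presheaf.stalkSpecializes h).hom) := by
  letI algxx' := (X.presheaf.stalkSpecializes h).hom.toAlgebra
  set P := (maximalIdeal (X.presheaf.stalk x')).comap (X.presheaf.stalkSpecializes h).hom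
    with hP
  -- an affine open neighbourhood `U = Spec A` of `x`; it contains the generization `x'`
  obtain ⟨U, hU, hxU, -⟩ :=
    exists_isAffineOpen_mem_and_subset (X := X) (x := x) (U := ⊤) trivial
  have hx'U : x' ∈ U := h.mem_open U.2 hxU
  let A := Γ(X, U)
  let Ox := X.presheaf.stalk x
  let Ox' := X.presheaf.stalk x'
  letI algx : Algebra A Ox := TopCat.Presheaf.algebra_section_stalk X.presheaf ⟨x, hxU⟩
  letI algx' : Algebra A Ox' := TopCat.Presheaf.algebra_section_stalk X.presheaf ⟨x', hx'U⟩
  let 𝔭 := (hU.primeIdealOf ⟨x, hxU⟩).asIdeal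
  let 𝔮 := (hU.primeIdealOf ⟨x', hx'U⟩).asIdeal
  haveI instx : IsLocalization.AtPrime Ox 𝔭 := hU.isLocalization_stalk ⟨x, hxU⟩
  haveI instx' : IsLocalization.AtPrime Ox' 𝔮 := hU.isLocalization_stalk ⟨x', hx'U⟩
  have halg : (algebraMap Ox Ox').comp (algebraMap A Ox) = algebraMap A Ox' := by
    show (X.presheaf.stalkSpecializes h).hom.comp (X.presheaf.germ U x hxU).hom =
      (X.presheaf.germ U x' hx'U).hom
    rw [← CommRingCat.hom_comp, TopCat.Presheaf.germ_stalkSpecializes]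
  haveI : IsScalarTower A Ox Ox' := IsScalarTower.of_algebraMap_eq' halg.symm
  -- the contraction of `P` to `A` is the prime `𝔮` of `x'`
  have hq : P.comap (algebraMap A Ox) = 𝔮 := by
    rw [hP, Ideal.comap_comap]
    change (maximalIdeal Ox').comap ((algebraMap Ox Ox').comp (algebraMap A Ox)) = 𝔮
    rw [halg]
    exact IsLocalization.AtPrime.under_maximalIdeal Ox' 𝔮
  -- `(𝒪_{X,x})_P` is a localization of `A` at `𝔮`, hence `A`-isomorphic to `𝒪_{X,x'}`
  let L := Localization.AtPrime P
  haveI instL : IsLocalization.AtPrime L 𝔮 := by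
    have hL :=
      IsLocalization.isLocalization_isLocalization_atPrime_isLocalization 𝔭.primeCompl L P
    convert hL using 2
    exact hq.symm
  let e : L ≃ₐ[A] Ox' := IsLocalization.algEquiv 𝔮.primeCompl L Ox'
  -- the isomorphism is `𝒪_{X,x}`-linear: both maps `𝒪_{X,x} → 𝒪_{X,x'}` agree on `A`
  have he : (e : L →+* Ox').comp (algebraMap Ox L) = algebraMap Ox Ox' := by
    refine IsLocalization.ringHom_ext 𝔭.primeCompl ?_
    ext a
    simp only [RingHom.coe_comp, Function.comp_apply]
    rw [← IsScalarTower.algebraMap_apply A Ox L, ← IsScalarTower.algebraMap_apply A Ox Ox']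
    exact e.commutes a
  let e' : L ≃ₐ[Ox] Ox' :=
    AlgEquiv.ofRingEquiv (f := e.toRingEquiv) fun r => RingHom.congr_fun he r
  exact IsLocalization.isLocalization_of_algEquiv P.primeCompl e'

/-- **Every prime of the stalk comes from a generization** (Stacks 01J7: the points of
`Spec 𝒪_{X,x}` are the generizations of `x`): for a prime `P ⊆ 𝒪_{X,x}` there is `x' ⤳ x`
with `P = (stalkSpecializes)⁻¹(𝔪_{x'})`. [cite: StacksProject, Tag 01J7] -/
theorem exists_specializes_comap_stalkSpecializes_eq (x : X) (P : Ideal (X.presheaf.stalk x))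
    [hPp : P.IsPrime] :
    ∃ (x' : X) (h : x' ⤳ x),
      P = (maximalIdeal (X.presheaf.stalk x')).comap (X.presheaf.stalkSpecializes h).hom := by
  obtain ⟨U, hU, hxU, -⟩ :=
    exists_isAffineOpen_mem_and_subset (X := X) (x := x) (U := ⊤) trivial
  let A := Γ(X, U)
  let Ox := X.presheaf.stalk x
  letI algx : Algebra A Ox := TopCat.Presheaf.algebra_section_stalk X.presheaf ⟨x, hxU⟩
  let 𝔭 := (hU.primeIdealOf ⟨x, hxU⟩).asIdeal
  haveI instx : IsLocalization.AtPrime Ox 𝔭 := hU.isLocalization_stalk ⟨x, hxU⟩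
  -- the prime `𝔮 = P ∩ A ⊆ 𝔭` and its point `x'`, a generization of `x`
  let q : PrimeSpectrum A := ⟨P.comap (algebraMap A Ox), Ideal.IsPrime.comap _⟩
  let x' : X := hU.fromSpec q
  have hx'U : x' ∈ U := hU.range_fromSpec.le ⟨q, rfl⟩
  have hq𝔭 : q ≤ hU.primeIdealOf ⟨x, hxU⟩ := by
    change P.comap (algebraMap A Ox) ≤ 𝔭
    rw [← IsLocalization.AtPrime.under_maximalIdeal Ox 𝔭]
    exact Ideal.comap_mono (le_maximalIdeal hPp.ne_top)
  have h : x' ⤳ x := by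
    have h1 : q ⤳ hU.primeIdealOf ⟨x, hxU⟩ := (PrimeSpectrum.le_iff_specializes _ _).mp hq𝔭
    have h2 := h1.map hU.fromSpec.continuous
    rwa [IsAffineOpen.fromSpec_primeIdealOf] at h2
  refine ⟨x', h, ?_⟩
  -- both primes of the localization `𝒪_{X,x} = A_𝔭` contract to `𝔮` in `A`
  let Ox' := X.presheaf.stalk x'
  letI algx' : Algebra A Ox' := TopCat.Presheaf.algebra_section_stalk X.presheaf ⟨x', hx'U⟩
  haveI instx' : IsLocalization.AtPrime Ox' q.asIdeal := hU.isLocalization_stalk' q hx'U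
  letI algxx' := (X.presheaf.stalkSpecializes h).hom.toAlgebra
  have halg : (algebraMap Ox Ox').comp (algebraMap A Ox) = algebraMap A Ox' := by
    show (X.presheaf.stalkSpecializes h).hom.comp (X.presheaf.germ U x hxU).hom =
      (X.presheaf.germ U x' hx'U).hom
    rw [← CommRingCat.hom_comp, TopCat.Presheaf.germ_stalkSpecializes]
  apply (IsLocalization.orderEmbedding 𝔭.primeCompl Ox).injective
  change P.comap (algebraMap A Ox) =
    ((maximalIdeal Ox').comap (X.presheaf.stalkSpecializes h).hom).comap (algebraMap A Ox)
  rw [Ideal.comap_comap]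
  change q.asIdeal = (maximalIdeal Ox').comap ((algebraMap Ox Ox').comp (algebraMap A Ox))
  rw [halg]
  exact (IsLocalization.AtPrime.under_maximalIdeal Ox' q.asIdeal).symm

end Literature.AlgebraicGeometry.Resolution

end
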